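import Literature.NumberTheory.Rogawski1990.ArchCharactersRealReduction          -- ★ A8 (p826869): `ArchTestKc.mulStar`, unimodularity imports, ★ `SemilocalCharactersLinIndep` (`ArchTestKc`)
import Literature.NumberTheory.Automorphic.WeightedHilbertSchmidtVanishingProofs   -- ★ A1 (p827101): `forall_weight_eq_zero_of_tsum_weighted_hilbertSchmidt_eq_zero`
import Literature.NumberTheory.Automorphic.UnitaryGroupArchCharacterTraceClass     -- ★ A5 text `ArchIntegratedOperatorTraceClass`
import Literature.NumberTheory.Automorphic.UnitaryGlobalizationsInequivalentProofs -- ★ A7 (p826222): `not_areUnitarilyEquivalent_globOfRecord_of_ne`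
import Literature.NumberTheory.Automorphic.UnitaryGlobalizationIrreducible         -- ★ A7′ text `UnitaryGlobalizationIrreducible`
import Literature.NumberTheory.Automorphic.HasUnitaryGlobalizationOfInfUnitary    -- ★ A6 text `HasUnitaryGlobalizationOfInfUnitary`
import Literature.NumberTheory.Automorphic.GKInfinitesimallyUnitary               -- ★ `GKIrrep.IsInfUnitaryAlongP`
import HarnessLib

/-!
# The archimedean factor of #85 for REAL coefficients — the INSTANTIATION of Labesse–Langlands' Lemma 6.1 (sub-goal (γ) of `stub_archAssembly`)

Topic `NumberTheory/Rogawski1990`; namespace `Literature.NumberTheory.Rogawski1990`; THEOREMS ONLY (no `def`, no named fact, no instance, no notation).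
Cell `hodgecm-mathlib`, F0∕P3, crux H413, books row #85 (L2-SA) [Rogawski1990, Prop. 13.8.1 p. 212 = «consequence of [JL] Lemma 16.1.1 (cf. [LL]
p. 768)»]: typ-T1a's line `T1a_ArchCharactersLinIndep` reduces the archimedean factor ★ `ArchCharactersLinIndep` to the text `ArchRealCase` (real
coefficient families with #85's support clause) via A8 (★ `archRealReduction`), and `ArchRealCase` is the output of its `stub_archAssembly`.

THIS FILE proves `ArchRealCase` — TOKEN FOR TOKEN the body of typ-T1a's `def ArchRealCase` (ED. 5 ceaa02e46cc51bb4 :93–:110) — from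
* `hTC` — the text of ★ `ArchIntegratedOperatorTraceClass` at every frame (A5, [Knapp1986, Thm. 10.2]; LETTER);
* `hGE : HasUnitaryGlobalizationOfInfUnitary` (A6, [KnappVogan1995, Thm. 0.6 (a)]; LETTER);
* `hIR : UnitaryGlobalizationIrreducible` (A7′, [KnappVogan1995, Thm. 0.4]; LETTER);
* `hα` — the in-house six-clause bridge (A6a): `IsAdmissibleGK r.ρK → r.IsInfUnitaryAlongP → Liu2021.LemD2.IsInfUnitary r.ρK r.ρ𝔤` on `U(2,1)`;
* `hβ` — TOKEN FOR TOKEN the body of typ-T1a's `def ArchTestKcPackage` (ED. 5 :133–:168): (a) `ArchTestKc` is closed under `φ ↦ φ^*` and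
  `⋆_{νinf}`, (b) bi-`K_c`-averages (unused here), (c) a Dirac sequence in `ArchTestKc`;
so that the Lines fold is `stub_archAssembly := fun _hW hTC hGE hIR => archRealCase_of_package hTC hGE hIR ‹α› ‹β›`.

THE PROOF = the abstract node A1 in its hypothesis-minimal, universe-polymorphic form ★ `forall_weight_eq_zero_of_tsum_weighted_hilbertSchmidt_eq_zero`
(A-p06 (g23), p827101) INSTANTIATED at: the index type `{y : Cinf ∕∕ b y ≠ 0}` (in `Type 1` — no `Shrink`, no countability); the Hilbert spaces and
representations `y ↦ ϖ_y ∘ archProjUForm` of the unitary globalizations OF RECORD (★ `globOfRecord`; they exist on the support by the support clause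
+ `hα` + `hGE`; unitary; topologically irreducible by `hIR` and ★ `isTopIrreducible_restrict_iff_of_surjective`; pairwise NOT unitarily equivalent by
★ `not_areUnitarilyEquivalent_globOfRecord_of_ne` and descent of an equivalence of pull-backs along the surjection ★ `archProjUForm_surjective`);
the Hilbert bases of record ★ `globBasis`; `B :=` the families `(ϖ_y ∘ proj)(φ)`, `φ ∈ ArchTestKc` (a `ℂ`-subspace: `ArchTestKc` is closed under
sums and scalars and the integrated operator is linear in `φ`), stable under left multiplication by `(ϖ_y(proj g))_y` (★ `apply_comp_integratedOperator`
and translation-closure of `ArchTestKc`, `K_c = ker archProjUForm` being normal), non-degenerate by the Dirac sequence (c); Hilbert–Schmidt along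
the bases by `hTC` (i); and the weight identity at `ψ := φ^* ⋆ φ ∈ ArchTestKc` ((a)): `archTr₀ y ψ = Σ_k ⟪e_k, (ϖ_y∘proj)(φ)^* (ϖ_y∘proj)(φ) e_k⟫ =
Σ_k ‖(ϖ_y∘proj)(φ) e_k‖²` (★ `archTr₀_eq_tsum`, ★ `integratedOperator_comp_integratedOperator`, ★ `adjoint_integratedOperator`), so the hypotheses
«`Σ_y b_y archTr₀ y ψ` summable and `= 0`» are exactly A1's weighted Hilbert–Schmidt hypothesis; A1 then says `b = 0` on the support — absurd unless the
support is empty.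
HONEST LABEL: A5, A6, A7′ stay LETTERS (hypotheses here); HC_CM is proved only modulo the printed citations until rung 0 closes.

## References
* Labesse–Langlands, *L-indistinguishability for SL(2)*, Canad. J. Math. 31 (1979), Lemma 6.1 pp. 768–769 · Rogawski, *Automorphic Representations of
  Unitary Groups in Three Variables* (1990), 13.8.1 p. 212, §14.2 p. 233 · Jacquet–Langlands, *Automorphic Forms on GL(2)* (1970), §16, L. 16.1.1 p. 498.
-/

set_option autoImplicit false

noncomputable section

open NumberField MeasureTheory CompactlySupported Filter Topology
open scoped Matrix ComplexConjugate InnerProductSpace ENNReal NNReal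

namespace Literature.NumberTheory.Rogawski1990

open Literature.NumberTheory.Automorphic Literature.NumberTheory.Automorphic.UnitaryGroup
open Literature.NumberTheory.Automorphic.UnitaryGroup.CotangentForms
open Literature.RepresentationTheory Literature.RepresentationTheory.KonnoKonno2007 Literature.RepresentationTheory.KonnoKonno2007.RealDualPair

/-! ## §1 Descent along a surjective homomorphism -/
section Descent

/-- **An equivalence of pull-backs along a SURJECTIVE homomorphism is an equivalence**: if `π ∘ p ≃ σ ∘ p` unitarily and `p : G' → G` is onto, then
`π ≃ σ` unitarily (the same isometric linear equivalence intertwines `π g = (π ∘ p) g'` for any `g'` over `g`).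
[cite: JacquetLanglands1970, §16, Lemma 16.1.1 (proof) p. 498] -/
theorem areUnitarilyEquivalent_of_restrict {G G' : Type*} [Group G] [Group G']
    {V W : Type*} [NormedAddCommGroup V] [InnerProductSpace ℂ V] [NormedAddCommGroup W] [InnerProductSpace ℂ W]
    {π : ContRepresentation ℂ G V} {σ : ContRepresentation ℂ G W} (p : G' →* G) (hp : Function.Surjective p)
    (h : ContRepresentation.AreUnitarilyEquivalent (π.restrict p) (σ.restrict p)) :
    ContRepresentation.AreUnitarilyEquivalent π σ := by
  obtain ⟨e, he⟩ := h
  refine ⟨ContRepresentation.Equiv.mk e.toContinuousLinearEquiv fun g => ?_, he⟩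
  obtain ⟨g', rfl⟩ := hp g
  have h1 := e.isIntertwining g'
  rw [ContRepresentation.restrict_apply, ContRepresentation.restrict_apply] at h1
  exact h1

/-- **Irreducibility of the pull-back along a surjective homomorphism**: the closed invariant subspaces of `π ∘ p` and of `π` are the same
lattice (the only-if half of ★ `isTopIrreducible_restrict_iff_of_surjective` of `CuspidalTypeOfResidual`, re-proved here to keep this file's import
closure inside the T1 engine). [cite: JacquetLanglands1970, §16, Lemma 16.1.1 (proof) p. 498] -/
theorem isTopIrreducible_restrict_of_surjective {G G' : Type*} [Group G] [Group G']
    {V : Type*} [NormedAddCommGroup V] [InnerProductSpace ℂ V]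
    {π : ContRepresentation ℂ G V} (p : G' →* G) (hp : Function.Surjective p) (h : π.IsTopIrreducible) :
    (π.restrict p).IsTopIrreducible := by
  -- adapted from ★ `Literature.NumberTheory.Automorphic.isTopIrreducible_restrict_iff_of_surjective`
  let e : ContRepresentation.ClosedSubrep (π.restrict p) ≃o ContRepresentation.ClosedSubrep π :=
    { toFun := fun W =>
        { toSubmodule := W.toSubmodule
          apply_mem_toSubmodule := fun g v hv => by
            obtain ⟨g', rfl⟩ := hp g
            exact W.apply_mem g' hv
          isClosed' := W.isClosed }
      invFun := fun W =>
        { toSubmodule := W.toSubmodule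
          apply_mem_toSubmodule := fun g' v hv => W.apply_mem (p g') hv
          isClosed' := W.isClosed }
      left_inv := fun W => by ext v; rfl
      right_inv := fun W => by ext v; rfl
      map_rel_iff' := fun {W W'} => Iff.rfl }
  exact e.isSimpleOrder_iff.2 h

end Descent

/-! ## §2 The `ℂ`-linear structure and the translation-closure of `ArchTestKc` -/
section TestAlgebra

open NumberField.mixedEmbedding
open scoped Classical

variable {L : Type} [Field L] [NumberField L] [IsCMField L] {ι : L →+* ℂ} {H : Matrix (Fin 3) (Fin 3) L} {T : GL (Fin 3) ℂ}
  {hT : (T : Matrix (Fin 3) (Fin 3) ℂ)ᴴ * H.map ι * (T : Matrix (Fin 3) (Fin 3) ℂ) = Literature.Geometry.ComplexHyperbolic.BallModel.J}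

/-- `ArchTestKc` is closed under sums («`B` is a subspace»). [cite: LabesseLanglands1979, Lemma 6.1 p. 768] -/
theorem ArchTestKc.add {φ ψ : UnitaryGroup.arch (↥(maximalRealSubfield L)) L (IsCMField.complexConj L) 3 H → ℂ}
    (hφ : ArchTestKc L ι H T hT φ) (hψ : ArchTestKc L ι H T hT ψ) : ArchTestKc L ι H T hT (φ + ψ) := by
  obtain ⟨⟨φ', hφ'c, hφ's, hφ'sm, hφ'⟩, hφr, hφl⟩ := hφ
  obtain ⟨⟨ψ', hψ'c, hψ's, hψ'sm, hψ'⟩, hψr, hψl⟩ := hψ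
  refine ⟨⟨φ' + ψ', hφ'c.add hψ'c, hφ's.add hψ's, (archSmooth _).add_mem hφ'sm hψ'sm, fun k => ?_⟩, fun k hk a => ?_, fun k hk a => ?_⟩
  · rw [Pi.add_apply, Pi.add_apply, hφ' k, hψ' k]
  · rw [Pi.add_apply, Pi.add_apply, hφr k hk a, hψr k hk a]
  · rw [Pi.add_apply, Pi.add_apply, hφl k hk a, hψl k hk a]

/-- `ArchTestKc` is closed under scalars («`B` is a subspace»). [cite: LabesseLanglands1979, Lemma 6.1 p. 768] -/
theorem ArchTestKc.smul {φ : UnitaryGroup.arch (↥(maximalRealSubfield L)) L (IsCMField.complexConj L) 3 H → ℂ}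
    (hφ : ArchTestKc L ι H T hT φ) (c : ℂ) : ArchTestKc L ι H T hT (c • φ) := by
  obtain ⟨⟨φ', hφ'c, hφ's, hφ'sm, hφ'⟩, hφr, hφl⟩ := hφ
  refine ⟨⟨c • φ', hφ'c.const_smul c, hφ's.smul_left, (archSmooth _).smul_mem c hφ'sm, fun k => ?_⟩, fun k hk a => ?_,
    fun k hk a => ?_⟩
  · rw [Pi.smul_apply, Pi.smul_apply, hφ' k]
  · rw [Pi.smul_apply, Pi.smul_apply, hφr k hk a]
  · rw [Pi.smul_apply, Pi.smul_apply, hφl k hk a]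

/-- `0 ∈ ArchTestKc` («`B` is a subspace»). [cite: LabesseLanglands1979, Lemma 6.1 p. 768] -/
theorem ArchTestKc.zero :
    ArchTestKc L ι H T hT (0 : UnitaryGroup.arch (↥(maximalRealSubfield L)) L (IsCMField.complexConj L) 3 H → ℂ) :=
  ⟨⟨0, continuous_const, HasCompactSupport.zero, (archSmooth _).zero_mem, fun _ => rfl⟩, fun _ _ _ => rfl, fun _ _ _ => rfl⟩

/-- **`ArchTestKc` is closed under left translation `φ ↦ φ(a⁻¹ ·)`** («`B` stable under left translation», the hypothesis `hG` of A1): clause (i)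
by ★ `IsArchSmooth.comp_mul_left` on `GL₃(L ⊗ ℝ)`; right `K_c`-invariance is untouched; left `K_c`-invariance because the archimedean part of
`K_c` is the KERNEL of ★ `archProjUForm` (★ `archProjUForm_ker`, ★ `cmCompactFactor` = its image under ★ `archToAdelic`), a normal subgroup.
[cite: JacquetLanglands1970, §16, Lemma 16.1.1 (proof) p. 498] [cite: Rogawski1990, §14.2 p. 233] -/
theorem ArchTestKc.comp_mul_left {φ : UnitaryGroup.arch (↥(maximalRealSubfield L)) L (IsCMField.complexConj L) 3 H → ℂ}
    (hφ : ArchTestKc L ι H T hT φ) (a : UnitaryGroup.arch (↥(maximalRealSubfield L)) L (IsCMField.complexConj L) 3 H) :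
    ArchTestKc L ι H T hT fun x => φ (a⁻¹ * x) := by
  obtain ⟨⟨φ', hφ'c, hφ's, hφ'sm, hφ'⟩, hφr, hφl⟩ := hφ
  refine ⟨⟨fun g => φ' (((a⁻¹ : UnitaryGroup.arch (↥(maximalRealSubfield L)) L (IsCMField.complexConj L) 3 H) :
        GL (Fin 3) (NumberField.mixedEmbedding.mixedSpace L)) * g),
      hφ'c.comp (continuous_const.mul continuous_id), ?_,
      IsArchSmooth.comp_mul_left _ hφ'sm (((a⁻¹ : UnitaryGroup.arch (↥(maximalRealSubfield L)) L (IsCMField.complexConj L) 3 H) :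
        GL (Fin 3) (NumberField.mixedEmbedding.mixedSpace L))), fun k => ?_⟩, fun k hk x => ?_, fun k hk x => ?_⟩
  · exact hφ's.comp_homeomorph (Homeomorph.mulLeft
      ((a⁻¹ : UnitaryGroup.arch (↥(maximalRealSubfield L)) L (IsCMField.complexConj L) 3 H) :
        GL (Fin 3) (NumberField.mixedEmbedding.mixedSpace L)))
  · change φ (a⁻¹ * k) = φ' (_ * _)
    rw [hφ' (a⁻¹ * k), Subgroup.coe_mul]
  · change φ (a⁻¹ * (x * _)) = φ (a⁻¹ * x)
    rw [← mul_assoc, hφr k hk]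
  · -- `a⁻¹ k x = (a⁻¹ k a) (a⁻¹ x)` with `a⁻¹ k a` again in the (normal) kernel
    change φ (a⁻¹ * (_ * x)) = φ (a⁻¹ * x)
    obtain ⟨k₀, hk₀, rfl⟩ := Subgroup.mem_map.1 hk
    have hpa : ∀ g : UnitaryGroup.arch (↥(maximalRealSubfield L)) L (IsCMField.complexConj L) 3 H,
        archPart (↥(maximalRealSubfield L)) L (IsCMField.complexConj L) 3 H
          (archToAdelic (↥(maximalRealSubfield L)) L (IsCMField.complexConj L) 3 H g) = g :=
      fun g => archPart_archToAdelic (↥(maximalRealSubfield L)) L (IsCMField.complexConj L) 3 H g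
    have hk₁ : a⁻¹ * k₀ * a ∈ (archProjU21EmbCM L H ι T (formCongr_eq_of_conjTranspose L ι H T hT)).ker := by
      rw [← archProjUForm_ker L ι H T hT] at hk₀ ⊢
      exact Subgroup.Normal.conj_mem' inferInstance k₀ hk₀ a
    have h1 := hφl (archToAdelic (↥(maximalRealSubfield L)) L (IsCMField.complexConj L) 3 H (a⁻¹ * k₀ * a))
      (Subgroup.mem_map_of_mem _ hk₁) (a⁻¹ * x)
    refine Eq.trans ?_ h1
    congr 1
    erw [hpa, hpa]
    group

end TestAlgebra

/-! ## §3 The assembly: `ArchRealCase` from A1 (★), A5, A6, A7 (★), A7′ and the in-house package -/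
section Assembly

open NumberField.mixedEmbedding
-- `Classical` ∕ `ComplexOrder`: the scopes under which typ-T1a's Lines texts `ArchRealCase` ∕ `ArchTestKcPackage` are elaborated (token-for-token match).
open scoped Classical ComplexOrder

/-- **`ArchRealCase` FROM THE PACKAGE — Labesse–Langlands' Lemma 6.1 INSTANTIATED** at the pulled-back unitary globalizations of record `y ↦ ϖ_y ∘ archProjUForm`
over the support of a real coefficient family `b` and the operator families of `ArchTestKc` functions (see the module docstring for the dictionary).
Hypotheses: `hTC` = the text of ★ `ArchIntegratedOperatorTraceClass` at every frame (A5), `hGE` = ★ text `HasUnitaryGlobalizationOfInfUnitary` (A6),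
`hIR` = ★ text `UnitaryGlobalizationIrreducible` (A7′), `hα` = the six-clause bridge (A6a), `hβ` = the body of typ-T1a's `ArchTestKcPackage` ((a) `*`-algebra,
(b) bi-`K_c`-averages — unused —, (c) Dirac sequence); conclusion = the body of typ-T1a's `ArchRealCase`.  Uses ★ A1 in the universe-polymorphic form
`forall_weight_eq_zero_of_tsum_weighted_hilbertSchmidt_eq_zero` and ★ A7 `not_areUnitarilyEquivalent_globOfRecord_of_ne`.
[cite: LabesseLanglands1979, Lemma 6.1 pp. 768–769] [cite: Rogawski1990, Prop. 13.8.1 p. 212] [cite: JacquetLanglands1970, §16, Lemma 16.1.1 (proof) p. 498] -/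
theorem archRealCase_of_package
    (hTC : ∀ (L : Type) [Field L] [NumberField L] [IsCMField L] (ι : L →+* ℂ) (H : Matrix (Fin 3) (Fin 3) L) (T : GL (Fin 3) ℂ)
      (hT : (T : Matrix (Fin 3) (Fin 3) ℂ)ᴴ * H.map ι * (T : Matrix (Fin 3) (Fin 3) ℂ) = Literature.Geometry.ComplexHyperbolic.BallModel.J)
      (νinf : @Measure (UnitaryGroup.arch (↥(maximalRealSubfield L)) L (IsCMField.complexConj L) 3 H) (borel _)),
      ArchIntegratedOperatorTraceClass L ι H T hT νinf)
    (hGE : HasUnitaryGlobalizationOfInfUnitary) (hIR : UnitaryGlobalizationIrreducible)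
    (hα : ∀ r : GKIrrep (uFormGroup (Fin 2) (Fin 1)), IsAdmissibleGK r.ρK → r.IsInfUnitaryAlongP → Liu2021.LemD2.IsInfUnitary r.ρK r.ρ𝔤)
    (hβ : ∀ (L : Type) [Field L] [NumberField L] [IsCMField L] (ι : L →+* ℂ) (H : Matrix (Fin 3) (Fin 3) L) (T : GL (Fin 3) ℂ)
      (hT : (T : Matrix (Fin 3) (Fin 3) ℂ)ᴴ * H.map ι * (T : Matrix (Fin 3) (Fin 3) ℂ) = Literature.Geometry.ComplexHyperbolic.BallModel.J)
      (νinf : @Measure (UnitaryGroup.arch (↥(maximalRealSubfield L)) L (IsCMField.complexConj L) 3 H) (borel _)),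
      letI : MeasurableSpace (UnitaryGroup.arch (↥(maximalRealSubfield L)) L (IsCMField.complexConj L) 3 H) := borel _
      haveI : BorelSpace (UnitaryGroup.arch (↥(maximalRealSubfield L)) L (IsCMField.complexConj L) 3 H) := ⟨rfl⟩
      (∀ τ' : L →+* ℂ, InfinitePlace.mk τ' ≠ InfinitePlace.mk ι → (H.map τ').PosDef) →
      ∀ (_hν : νinf.IsHaarMeasure),
        -- (a) `*`-algebra
        (∀ φ : UnitaryGroup.arch (↥(maximalRealSubfield L)) L (IsCMField.complexConj L) 3 H → ℂ, ArchTestKc L ι H T hT φ →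
            ArchTestKc L ι H T hT (mulStar φ) ∧
            ∀ ψ : UnitaryGroup.arch (↥(maximalRealSubfield L)) L (IsCMField.complexConj L) 3 H → ℂ, ArchTestKc L ι H T hT ψ →
              ArchTestKc L ι H T hT (mulConv νinf φ ψ)) ∧
        -- (b) bi-`K_c`-average with the same operator on `K_c`-trivial representations
        (∀ ψ : UnitaryGroup.arch (↥(maximalRealSubfield L)) L (IsCMField.complexConj L) 3 H → ℂ, ∀ (hψc : Continuous ψ) (hψs : HasCompactSupport ψ),
            (∃ ψ' : GL (Fin 3) (NumberField.mixedEmbedding.mixedSpace L) → ℂ, Continuous ψ' ∧ HasCompactSupport ψ' ∧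
                IsArchSmooth (archGroupGL 3 L).carrier.subtype ψ' ∧
                ∀ k : UnitaryGroup.arch (↥(maximalRealSubfield L)) L (IsCMField.complexConj L) 3 H,
                  ψ k = ψ' (k : GL (Fin 3) (NumberField.mixedEmbedding.mixedSpace L))) →
            ∃ (ψn : UnitaryGroup.arch (↥(maximalRealSubfield L)) L (IsCMField.complexConj L) 3 H → ℂ) (hψn : ArchTestKc L ι H T hT ψn),
              ∀ (x : GKIrrClass (uFormGroup (Fin 2) (Fin 1)))
                (E : Type) [NormedAddCommGroup E] [InnerProductSpace ℂ E] [CompleteSpace E]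
                (ϖ : ContRepresentation ℂ (uFormGroup (Fin 2) (Fin 1)).carrier E) (hϖ : IsUnitaryGlobalization (uFormGroup (Fin 2) (Fin 1)) x ϖ),
                (ϖ.restrict (archProjUForm L ι H T hT)).integratedOperator (hϖ.isUnitary.restrict _)
                    (hϖ.isStronglyContinuous.restrict _ (continuous_archProjUForm L ι H T hT)) νinf ⟨⟨ψn, hψn.continuous⟩, hψn.hasCompactSupport⟩ =
                  (ϖ.restrict (archProjUForm L ι H T hT)).integratedOperator (hϖ.isUnitary.restrict _)
                    (hϖ.isStronglyContinuous.restrict _ (continuous_archProjUForm L ι H T hT)) νinf ⟨⟨ψ, hψc⟩, hψs⟩) ∧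
        -- (c) Dirac sequence in `ArchTestKc` for the `K_c`-trivial unitary globalizations
        (∃ (φn : ℕ → UnitaryGroup.arch (↥(maximalRealSubfield L)) L (IsCMField.complexConj L) 3 H → ℂ) (hφn : ∀ n, ArchTestKc L ι H T hT (φn n)),
            ∀ (x : GKIrrClass (uFormGroup (Fin 2) (Fin 1)))
              (E : Type) [NormedAddCommGroup E] [InnerProductSpace ℂ E] [CompleteSpace E]
              (ϖ : ContRepresentation ℂ (uFormGroup (Fin 2) (Fin 1)).carrier E) (hϖ : IsUnitaryGlobalization (uFormGroup (Fin 2) (Fin 1)) x ϖ) (v : E),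
              Tendsto (fun n => (ϖ.restrict (archProjUForm L ι H T hT)).integratedOperator (hϖ.isUnitary.restrict _)
                  (hϖ.isStronglyContinuous.restrict _ (continuous_archProjUForm L ι H T hT)) νinf
                  ⟨⟨φn n, (hφn n).continuous⟩, (hφn n).hasCompactSupport⟩ v) atTop (𝓝 v))) :
    ∀ (L : Type) [Field L] [NumberField L] [IsCMField L] (ι : L →+* ℂ) (H : Matrix (Fin 3) (Fin 3) L) (T : GL (Fin 3) ℂ)
      (hT : (T : Matrix (Fin 3) (Fin 3) ℂ)ᴴ * H.map ι * (T : Matrix (Fin 3) (Fin 3) ℂ) = Literature.Geometry.ComplexHyperbolic.BallModel.J)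
      (νinf : @Measure (UnitaryGroup.arch (↥(maximalRealSubfield L)) L (IsCMField.complexConj L) 3 H) (borel _)),
      (∀ τ' : L →+* ℂ, InfinitePlace.mk τ' ≠ InfinitePlace.mk ι → (H.map τ').PosDef) →
      @Measure.IsHaarMeasure _ _ _ (borel _) νinf →
      ∀ (b : GKIrrClass (uFormGroup (Fin 2) (Fin 1)) → ℝ),
        (∀ y, b y ≠ 0 →
          ∃ r : GKIrrep (uFormGroup (Fin 2) (Fin 1)), GKIrrClass.mk r = y ∧ IsAdmissibleGK r.ρK ∧ r.IsInfUnitaryAlongP) →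
        (∀ φ : UnitaryGroup.arch (↥(maximalRealSubfield L)) L (IsCMField.complexConj L) 3 H → ℂ,
            ArchTestKc L ι H T hT φ → Summable fun y => (b y : ℂ) * archTr₀ L ι H T hT νinf y φ) →
        (∀ φ : UnitaryGroup.arch (↥(maximalRealSubfield L)) L (IsCMField.complexConj L) 3 H → ℂ,
            ArchTestKc L ι H T hT φ → ∑' y, (b y : ℂ) * archTr₀ L ι H T hT νinf y φ = 0) →
        ∀ y, b y = 0 := by
  intro L _ _ _ ι H T hT νinf hdef hν b hsupp hsum hzero y₀
  by_contra hy₀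
  /- measure-theoretic instances on `G′_∞` -/
  letI mS : MeasurableSpace (UnitaryGroup.arch (↥(maximalRealSubfield L)) L (IsCMField.complexConj L) 3 H) := borel _
  haveI : BorelSpace (UnitaryGroup.arch (↥(maximalRealSubfield L)) L (IsCMField.complexConj L) 3 H) := ⟨rfl⟩
  haveI : νinf.IsHaarMeasure := hν
  haveI : νinf.IsMulRightInvariant :=
    isMulRightInvariant_of_modularCharacterFun_eq_one
      (fun g => modularCharacterFun_arch_eq_one L H (transpose_map_cmConjRingHom_eq_of_frame L ι H T hT)
        (isUnit_det_of_frame L ι H T hT).ne_zero g) νinf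
  haveI : νinf.IsInvInvariant := isInvInvariant_of_isMulRightInvariant νinf
  /- the package at this frame -/
  obtain ⟨hβa, -, φn, hφn, hDirac⟩ := hβ L ι H T hT νinf hdef hν
  /- unitary globalizations exist on the support (support clause + A6a + A6) -/
  have hglob : ∀ y : GKIrrClass (uFormGroup (Fin 2) (Fin 1)), b y ≠ 0 → HasUnitaryGlobalization (uFormGroup (Fin 2) (Fin 1)) y := by
    intro y hy
    obtain ⟨r, hr, hadm, hinf⟩ := hsupp y hy
    rw [← hr]
    exact hGE (Fin 2) (Fin 1) r hadm (hα r hadm hinf)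
  /- the globalization of record `W y` on the support, its pull-back `π y` to `G′_∞` (unitary, strongly continuous, irreducible, inequivalent) -/
  let W : (y : {y : GKIrrClass (uFormGroup (Fin 2) (Fin 1)) // b y ≠ 0}) → UnitaryGlobalization (G := uFormGroup (Fin 2) (Fin 1)) y.1 :=
    fun y => globOfRecord y.1 (hglob y.1 y.2)
  let π : (y : {y : GKIrrClass (uFormGroup (Fin 2) (Fin 1)) // b y ≠ 0}) →
      ContRepresentation ℂ (UnitaryGroup.arch (↥(maximalRealSubfield L)) L (IsCMField.complexConj L) 3 H) (W y).E :=
    fun y => (W y).ϖ.restrict (archProjUForm L ι H T hT)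
  have hu : ∀ y, (π y).IsUnitary := fun y => (W y).isUnitaryGlobalization.isUnitary.restrict _
  have hc : ∀ y, (π y).IsStronglyContinuous := fun y =>
    (W y).isUnitaryGlobalization.isStronglyContinuous.restrict _ (continuous_archProjUForm L ι H T hT)
  have hirrW : ∀ y, (W y).ϖ.IsTopIrreducible := fun y => by
    obtain ⟨r, hr, hadm, -⟩ := hsupp y.1 y.2
    exact hIR (Fin 2) (Fin 1) y.1 ⟨r, hr, hadm⟩ (W y).E (W y).ϖ (W y).isUnitaryGlobalization
  have hirr : ∀ y, (π y).IsTopIrreducible := fun y =>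
    isTopIrreducible_restrict_of_surjective _ (archProjUForm_surjective L ι H T hT) (hirrW y)
  have hne : ∀ y y', y ≠ y' → ¬ ContRepresentation.AreUnitarilyEquivalent (π y) (π y') := fun y y' hyy' he =>
    not_areUnitarilyEquivalent_globOfRecord_of_ne (fun h => hyy' (Subtype.ext h)) (hglob y.1 y.2) (hglob y'.1 y'.2)
      (areUnitarilyEquivalent_of_restrict _ (archProjUForm_surjective L ι H T hT) he)
  /- the subspace `B` of the operator families `((ϖ_y ∘ proj)(f))_y`, `f ∈ ArchTestKc` -/
  have hOp_add : ∀ y (f f' : C_c(UnitaryGroup.arch (↥(maximalRealSubfield L)) L (IsCMField.complexConj L) 3 H, ℂ)),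
      (π y).integratedOperator (hu y) (hc y) νinf (f + f') =
        (π y).integratedOperator (hu y) (hc y) νinf f + (π y).integratedOperator (hu y) (hc y) νinf f' := fun y f f' =>
    ContRepresentation.integratedOperator_add (hu y) (hc y) νinf f f'
  have hOp_smul : ∀ y (c : ℂ) (f : C_c(UnitaryGroup.arch (↥(maximalRealSubfield L)) L (IsCMField.complexConj L) 3 H, ℂ)),
      (π y).integratedOperator (hu y) (hc y) νinf (c • f) = c • (π y).integratedOperator (hu y) (hc y) νinf f := fun y c f =>
    ContRepresentation.integratedOperator_smul (hu y) (hc y) νinf c f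
  have hOp_zero : ∀ y, (π y).integratedOperator (hu y) (hc y) νinf 0 = 0 := fun y => by
    rw [← zero_smul ℂ (0 : C_c(UnitaryGroup.arch (↥(maximalRealSubfield L)) L (IsCMField.complexConj L) 3 H, ℂ)), hOp_smul, zero_smul]
  obtain ⟨B, hBmem⟩ : ∃ B : Submodule ℂ (∀ y : {y : GKIrrClass (uFormGroup (Fin 2) (Fin 1)) // b y ≠ 0}, (W y).E →L[ℂ] (W y).E),
      ∀ F, F ∈ B ↔ ∃ f : C_c(UnitaryGroup.arch (↥(maximalRealSubfield L)) L (IsCMField.complexConj L) 3 H, ℂ),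
        ArchTestKc L ι H T hT f ∧ ∀ y, F y = (π y).integratedOperator (hu y) (hc y) νinf f :=
    ⟨{ carrier := {F | ∃ f : C_c(UnitaryGroup.arch (↥(maximalRealSubfield L)) L (IsCMField.complexConj L) 3 H, ℂ),
          ArchTestKc L ι H T hT f ∧ ∀ y, F y = (π y).integratedOperator (hu y) (hc y) νinf f}
       add_mem' := by
         rintro F F' ⟨f, hf, hF⟩ ⟨f', hf', hF'⟩
         exact ⟨f + f', hf.add hf', fun y => by rw [Pi.add_apply, hF, hF', hOp_add]⟩
       zero_mem' := ⟨0, ArchTestKc.zero, fun y => by rw [Pi.zero_apply, hOp_zero]⟩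
       smul_mem' := by
         rintro c F ⟨f, hf, hF⟩
         exact ⟨c • f, hf.smul c, fun y => by rw [Pi.smul_apply, hF, hOp_smul]⟩ }, fun F => Iff.rfl⟩
  /- `B` is stable under left multiplication by `(ϖ_y(proj g))_y` (translation-closure of `ArchTestKc`) -/
  have hG : ∀ (g : UnitaryGroup.arch (↥(maximalRealSubfield L)) L (IsCMField.complexConj L) 3 H), ∀ F ∈ B,
      (fun y => π y g * F y) ∈ B := by
    intro g F hF
    obtain ⟨f, hf, hFf⟩ := (hBmem F).1 hF
    have hfg : ArchTestKc L ι H T hT fun x => f (g⁻¹ * x) := hf.comp_mul_left g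
    refine (hBmem _).2 ⟨⟨⟨fun x => f (g⁻¹ * x), hfg.continuous⟩, hfg.hasCompactSupport⟩, hfg, fun y => ?_⟩
    rw [hFf y]
    exact ContRepresentation.apply_comp_integratedOperator (hu y) (hc y) νinf g f _ fun x => rfl
  /- `B` is non-degenerate on every `ϖ_y ∘ proj` (Dirac sequence (c)) -/
  have hnd : ∀ y, ∃ F ∈ B, F y ≠ 0 := by
    intro y
    haveI : Nontrivial (W y).E := ((ContRepresentation.isTopIrreducible_iff _).1 (hirrW y)).1
    obtain ⟨v, hv⟩ := exists_ne (0 : (W y).E)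
    by_contra hall
    push Not at hall
    have hT := hDirac y.1 (W y).E (W y).ϖ (W y).isUnitaryGlobalization v
    have h0 : ∀ n, (π y).integratedOperator (hu y) (hc y) νinf ⟨⟨φn n, (hφn n).continuous⟩, (hφn n).hasCompactSupport⟩ v = 0 := by
      intro n
      have hmem := (hBmem fun y' => (π y').integratedOperator (hu y') (hc y') νinf
        ⟨⟨φn n, (hφn n).continuous⟩, (hφn n).hasCompactSupport⟩).2 ⟨_, hφn n, fun y' => rfl⟩
      rw [hall _ hmem, zero_apply]
    have hT0 : Tendsto (fun _ : ℕ => (0 : (W y).E)) atTop (𝓝 v) := hT.congr fun n => h0 n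
    exact hv (tendsto_nhds_unique hT0 tendsto_const_nhds)
  /- Hilbert–Schmidt along the bases of record (A5 (i)) -/
  have hHS : ∀ F ∈ B, ∀ y, Summable fun k => ‖F y (globBasis y.1 (hglob y.1 y.2) k)‖ ^ 2 := by
    intro F hF y
    obtain ⟨f, hf, hFf⟩ := (hBmem F).1 hF
    have h1 := (hTC L ι H T hT νinf hν y.1 (W y).E (W y).ϖ (W y).isUnitaryGlobalization f f.continuous f.hasCompactSupport hf.1
      _ (globBasis y.1 (hglob y.1 y.2))).1
    have h1' : (∑' k, (‖(π y).integratedOperator (hu y) (hc y) νinf f (globBasis y.1 (hglob y.1 y.2) k)‖₊ : ℝ≥0∞) ^ 2) ≠ ∞ :=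
      h1.ne
    have hs : Summable fun k => ‖(π y).integratedOperator (hu y) (hc y) νinf f (globBasis y.1 (hglob y.1 y.2) k)‖₊ ^ 2 := by
      rw [← ENNReal.tsum_coe_ne_top_iff_summable]
      simpa only [ENNReal.coe_pow] using h1'
    rw [hFf y]
    simpa only [NNReal.coe_pow, coe_nnnorm] using NNReal.summable_coe.2 hs
  /- the weights: `b y · Θ_y(f^* ⋆ f) = b y · ‖(ϖ_y ∘ proj)(f)‖²_{HS}` on the support, so (6.1) holds on `B` -/
  have hl : ∀ F ∈ B, Summable (fun y : {y : GKIrrClass (uFormGroup (Fin 2) (Fin 1)) // b y ≠ 0} =>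
        b y.1 * ∑' k, ‖F y (globBasis y.1 (hglob y.1 y.2) k)‖ ^ 2) ∧
      ∑' y : {y : GKIrrClass (uFormGroup (Fin 2) (Fin 1)) // b y ≠ 0}, b y.1 * ∑' k, ‖F y (globBasis y.1 (hglob y.1 y.2) k)‖ ^ 2 = 0 := by
    intro F hF
    obtain ⟨f, hf, hFf⟩ := (hBmem F).1 hF
    have hfs : ArchTestKc L ι H T hT (mulStar ⇑f) := (hβa _ hf).1
    have hψ : ArchTestKc L ι H T hT (mulConv νinf (mulStar ⇑f) ⇑f) := (hβa _ hfs).2 _ hf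
    let fs : C_c(UnitaryGroup.arch (↥(maximalRealSubfield L)) L (IsCMField.complexConj L) 3 H, ℂ) :=
      ⟨⟨mulStar ⇑f, hfs.continuous⟩, hfs.hasCompactSupport⟩
    let ψ : C_c(UnitaryGroup.arch (↥(maximalRealSubfield L)) L (IsCMField.complexConj L) 3 H, ℂ) :=
      ⟨⟨mulConv νinf (mulStar ⇑f) ⇑f, hψ.continuous⟩, hψ.hasCompactSupport⟩
    -- the termwise identity on the support
    have hid : ∀ y : {y : GKIrrClass (uFormGroup (Fin 2) (Fin 1)) // b y ≠ 0},
        (b y.1 : ℂ) * archTr₀ L ι H T hT νinf y.1 (mulConv νinf (mulStar ⇑f) ⇑f) =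
          ((b y.1 * ∑' k, ‖F y (globBasis y.1 (hglob y.1 y.2) k)‖ ^ 2 : ℝ) : ℂ) := by
      intro y
      have hcomp : (π y).integratedOperator (hu y) (hc y) νinf ψ =
          (π y).integratedOperator (hu y) (hc y) νinf fs ∘L (π y).integratedOperator (hu y) (hc y) νinf f :=
        (ContRepresentation.integratedOperator_comp_integratedOperator (hu y) (hc y) νinf fs f ψ fun x => rfl).symm
      have hadj : (π y).integratedOperator (hu y) (hc y) νinf fs =
          ContinuousLinearMap.adjoint ((π y).integratedOperator (hu y) (hc y) νinf f) :=
        (ContRepresentation.adjoint_integratedOperator (hu y) (hc y) νinf f fs fun x => rfl).symm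
      rw [archTr₀_eq_tsum L ι H T hT νinf y.1 _ (hglob y.1 y.2) hψ.continuous hψ.hasCompactSupport inferInstance,
        Complex.ofReal_mul, Complex.ofReal_tsum]
      congr 1
      refine tsum_congr fun k => ?_
      change ⟪(globBasis y.1 (hglob y.1 y.2) k : (W y).E), (π y).integratedOperator (hu y) (hc y) νinf ψ (globBasis y.1 (hglob y.1 y.2) k)⟫_ℂ = _
      rw [hcomp, ContinuousLinearMap.comp_apply, hadj, ContinuousLinearMap.adjoint_inner_right, hFf y, inner_self_eq_norm_sq_to_K]
      norm_cast
    have hfun : (fun y : GKIrrClass (uFormGroup (Fin 2) (Fin 1)) => (b y : ℂ) * archTr₀ L ι H T hT νinf y (mulConv νinf (mulStar ⇑f) ⇑f)) ∘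
          (Subtype.val : {y : GKIrrClass (uFormGroup (Fin 2) (Fin 1)) // b y ≠ 0} → GKIrrClass (uFormGroup (Fin 2) (Fin 1))) =
        fun y => ((b y.1 * ∑' k, ‖F y (globBasis y.1 (hglob y.1 y.2) k)‖ ^ 2 : ℝ) : ℂ) := funext hid
    have hs : Summable fun y : {y : GKIrrClass (uFormGroup (Fin 2) (Fin 1)) // b y ≠ 0} =>
        ((b y.1 * ∑' k, ‖F y (globBasis y.1 (hglob y.1 y.2) k)‖ ^ 2 : ℝ) : ℂ) := by
      rw [← hfun]
      exact (hsum _ hψ).subtype _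
    refine ⟨Complex.summable_ofReal.1 hs, ?_⟩
    have htot := hzero _ hψ
    rw [← tsum_subtype_eq_of_support_subset (s := {y : GKIrrClass (uFormGroup (Fin 2) (Fin 1)) | b y ≠ 0}) ?_] at htot
    · have h2 : ∑' y : {y : GKIrrClass (uFormGroup (Fin 2) (Fin 1)) // b y ≠ 0},
          ((b y.1 * ∑' k, ‖F y (globBasis y.1 (hglob y.1 y.2) k)‖ ^ 2 : ℝ) : ℂ) = 0 := by
        rw [← htot]
        exact (tsum_congr fun y => (hid y).symm)
      rw [← Complex.ofReal_tsum] at h2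
      exact_mod_cast h2
    · intro y hy
      rw [Function.mem_support] at hy
      intro hby
      exact hy (by rw [show b y = 0 from hby, Complex.ofReal_zero, zero_mul])
  /- Labesse–Langlands' Lemma 6.1 (★ A1): every weight on the support vanishes — absurd at `y₀` -/
  exact hy₀ (forall_weight_eq_zero_of_tsum_weighted_hilbertSchmidt_eq_zero π hu hirr hne B hG hnd
    (fun y => globBasis y.1 (hglob y.1 y.2)) hHS (fun y => b y.1) hl ⟨y₀, hy₀⟩)

end Assembly

end Literature.NumberTheory.Rogawski1990

end
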